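import Summits.QuantumFields.YangMills.Theorems.AlphaInputsT3ACv3Lane
import Summits.QuantumFields.Balaban3D.Proofs.RestrictedResiduals
import HarnessLib

/-!
# `AlphaInputsT3ACv3LaneCore` — THE ROW-STABLE DATA CORE OF THE LANE'S VERSION-3 (α) INPUT PACKAGE («R-57χ» ADDITIVE form, owner RULING g23-№2 ADDENDUM 6 §3, cell ym3-torus,
# 2026-08-27): the 23 step rows of `AlphaV3AC.StepAlphaV3AC` that do not read the lower residual, + (67)/(68), as structures BOTH the old record and the χ-record
# (`AlphaInputsT3ACv3LaneChi`) project to; the seven χ-free residual leaves and the exponent bookkeeping ((41)_{k+1}, and the χ-free lower step) derived ONCE from the core —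
# lane `pub-balaban3d`, seat alpha-1 (g9)

WHY.  The lane's R3D-02 `fibre57Low : Bound55AC.Fibre57LowAC …` is retired from the live DAG (tower's (4) field window inside the lower row; false at `L ∈ {3,5}`, cell finding #44) and
replaced ADDITIVELY by print's row under new names (director's Q-57χ-1 ruling).  Every consumer that never read the lower row (the (41)-side: windowed weights, (55)-rows, (71) small
factors, the slack/canon producers of 3⁗/(i)*) should port ONCE and be immune to future row repairs: it reads the CORE.  Field names are `StepAlphaV3AC`'s VERBATIM (owner ADDENDUM 6 §2).

CONTENTS (HYPOTHESIS SCHEMAS `structure … : Prop`, never asserted; everything else proved): §1 `StepAlphaV3CoreAC` (23 rows, texts verbatim; `fibre55Win` is `PinnedStep.Fibre55WinAC` by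
name so R-g18-a/B2 is inherited), `RunAlphaV3CoreAC` (+ `hLF67`, `h68`), projections `StepAlphaV3AC.toCore`, `RunAlphaV3AC.toCore`; §2 the seven χ-free residual step leaves
`StepResidualsV3CoreAC` (C3–C8, C10) from the core rows (`stepResidualsV3Core_of_alpha`); §3 exponent bookkeeping: (41)_{k+1} (`expo5558_le_expo41_succ_CoreAC` /
`…_of_alphaV3Core`, via v3Lane's unbundled `expo5558_le_expo41_succ_of_leaves`) and the χ-FREE lower step (47)_{k+1} ≤ (37)/(57) (`expo47_succ_le_expo57_CoreAC` = the lane's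
`RestrictedResiduals.expo47_succ_le_expo57` — the arithmetic of LQB's `ineq47_succ_of_leaves`, exponent as conclusion — at `piecesAC`).  L-floor: the lane's.

References: T. Bałaban, Commun. Math. Phys. 102 (1985) 255–275 [Balaban1985UV3]; Commun. Math. Phys. 102 (1985) 277–309 [Balaban1985Variational].
-/

set_option autoImplicit false

noncomputable section

namespace Summit.QuantumFields.YangMills.Theorems.AlphaV3AC

open MeasureTheory Metric
open scoped BigOperators Matrix.Norms.L2Operator
open Literature.MathematicalPhysics.QuantumFieldTheory.Balaban1983to89
open Literature.MathematicalPhysics.QuantumFieldTheory.Balaban1983to89.B10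
open Literature.MathematicalPhysics.QuantumFieldTheory.Balaban1983to89.B10SectAGathering
open Literature.MathematicalPhysics.QuantumFieldTheory.Balaban1983to89.B10SectCExpansion (Bound44)
open Literature.MathematicalPhysics.QuantumFieldTheory.Balaban1983to89.B10Eq24Cumulant (chiMeasure)
open Literature.MathematicalPhysics.QuantumFieldTheory.Balaban1983to89.TreeLengthTorus (tsys)
open Literature.MathematicalPhysics.QuantumFieldTheory.Balaban1985CMP102
open Literature.MathematicalPhysics.QuantumFieldTheory.Balaban1985CMP102.Setting
open Literature.MathematicalPhysics.QuantumFieldTheory.Balaban1985CMP102.Binders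
  (ChartAnalyticityAsCited FarTermsDecayAsCited Norm35StepAsCited LogZTExtensiveAsCited GraphRep23AsCited)
open Summit.QuantumFields.Balaban3D.Carriers
open Summit.QuantumFields.Balaban3D.Proofs.ScalesArithmetic (gk_pos gk_le_one)
open Summit.QuantumFields.Balaban3D.Proofs.Inputs
open Summit.QuantumFields.Balaban3D.Proofs.Primitives
open Summit.QuantumFields.Balaban3D.Proofs.UVStability3DInputs (adjAct hdet_adjAct)
open Summit.QuantumFields.Balaban3D.Proofs.Representation33 (jet26)
open Summit.QuantumFields.Balaban3D.Proofs.LiftBridge (liftCfg)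
open Summit.QuantumFields.Balaban3D.Proofs.Run3SmallFactors (codeZ)
open Summit.QuantumFields.Balaban3D.Proofs.GroupModelLieC (lieC)
open Summit.QuantumFields.Balaban3D.Proofs.FamilyLE (thresholds_of_le)
open Summit.QuantumFields.Balaban3D.Proofs.TowerAC
open Summit.QuantumFields.Balaban3D.Proofs.SeriesAC
open Summit.QuantumFields.Balaban3D.Proofs.StandardAC
open Summit.QuantumFields.Balaban3D.Proofs.InputsAC
open Summit.QuantumFields.Balaban3D.Proofs.Bound55AC
open Summit.QuantumFields.Balaban3D.Proofs.AlphaAC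
open Summit.QuantumFields.Balaban3D.Proofs.AlphaAdaptersAC
open Summit.QuantumFields.Balaban3D.Proofs.Thm2AC (oldOutside_piecesAC step0_towerOfAC)
open B7Prop1Explicit (hol plaqWord)
open B7Prop1Local (pdevOn loK plaqHiK)
open B7Prop2Explicit (avgIter)

variable {L : ℕ}

/-! ## §1 The core step and run packages, and the projections from the old record -/

section Alpha

variable {S : Scales L} {G : Type} [GaugeGroup G] [MeasurableSpace G] [HaarData G] (𝔊 : GroupModel G) (𝔠 : AlphaConsts L 𝔊.N)
  (X : ExternalInputsAC S G) (𝔖 : ∀ k, StepSeries S G ↥(lieC 𝔊) (nblkOf S 𝔠.lane.carrier k) k) (𝔄 : AlphaDataAC 𝔊 𝔠 X 𝔖)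
  (win : (k : ℕ) → Hist S.P (k + 1) → Set (GaugeField S.P (k + 1) G))

open Classical in
/-- **THE ROW-STABLE DATA CORE OF THE VERSION-3 (α) STEP INPUTS `k → k+1`**: the 23 rows of `AlphaV3AC.StepAlphaV3AC k` that do NOT read the lower residual — VERBATIM (same field
names, same texts, same locators; the (55)-row `fibre55Win` is `PinnedStep.Fibre55WinAC` by name, so R-g18-a/B2 is inherited).  Both the old record (`StepAlphaV3AC.toCore`) and the
χ-record (`StepAlphaV3ChiAC extends` it) project to it, so every consumer of these rows is stated ONCE over the core (owner ADDENDUM 6 §3).  HYPOTHESES; nothing asserted.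
[cite: Balaban1985UV3, (23)–(33) pp.262–264 + (44) p.267 + (49)–(63) pp.268–272] -/
structure StepAlphaV3CoreAC (k : ℕ) : Prop where
  /-- the Gaussian measure of (58) is a probability measure -/
  hμ : IsProbabilityMeasure (𝔖 k).μ
  /-- the small-field box is measurable -/
  hboxm : ∀ h, MeasurableSet ((𝔖 k).box h)
  /-- … of positive measure -/
  hbox : ∀ h, (𝔖 k).μ ((𝔖 k).box h) ≠ 0
  /-- the effective potential is a.e.-measurable -/
  hVm : ∀ h U, AEMeasurable ((𝔖 k).𝒱 h U) (𝔖 k).μ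
  /-- … and bounded on the box -/
  hVB : ∀ h U, ∀ ω ∈ (𝔖 k).box h, |(𝔖 k).𝒱 h U ω| ≤ 𝔄.Bv k
  /-- G3D-01 at the (25)-rate (R-ACT) -/
  chart : ∀ Y, ChartAnalyticityAsCited ((𝔖 k).Ψ Y) 𝔠.ρ
    (𝔠.C25 * S.gk k * Real.exp (-(𝔠.κ * (tsys 3 (nblkOf S 𝔠.lane.carrier k)).dj Y)))
  /-- (28) p. 263 -/
  bound28 : ∀ Y h U, ‖(𝔖 k).Bcfg Y h U‖ ≤ 𝔠.cB * (rFun 𝔠.r₀ (S.gk k) * S.gk k * pFun 𝔠.b₀ 𝔠.p₀ (S.gk k))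
  /-- (26) in the chart space, for the adjoint action -/
  inv26 : ∀ Y (U : G), ∀ b ∈ ball (0 : (𝔖 k).E) 𝔠.ρ, adjAct 𝔊 (P := S.P) k U b ∈ ball (0 : (𝔖 k).E) 𝔠.ρ →
    (𝔖 k).Ψ Y (adjAct 𝔊 (P := S.P) k U b) = (𝔖 k).Ψ Y b
  /-- G3D-06 -/
  far_le : FarTermsDecayAsCited (𝔖 k).far
    (fun Y => 𝔠.C25 * S.gk k * Real.exp (-(𝔠.κ * (tsys 3 (nblkOf S 𝔠.lane.carrier k)).dj Y)))
    𝔠.Cfar (S.gk k ^ 7 * (rFun 𝔠.r₀ (S.gk k) * pFun 𝔠.b₀ 𝔠.p₀ (S.gk k)) ^ 7)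
  /-- identification of `PY` with the retained jet (batch 11 (a)) -/
  hPY : ∀ h U, (𝔖 k).PY h U
    = ∑ Y ∈ (𝔖 k).loc (ΩblkOf 𝔠.lane.carrier.M₁ (rcolOf S 𝔠.lane.carrier) (nblkOf S 𝔠.lane.carrier k)) (rretOf S 𝔠.lane.carrier k) h,
        ((jet26 ((𝔖 k).Ψ Y) ((𝔖 k).Bcfg Y h U)).re - (𝔖 k).far Y h U)
  /-- identification of `PYZ` with the retained jet of the G3D-07 pieces -/
  hPYZ : ∀ h U, (𝔖 k).PYZ h U
    = ∑ Y ∈ (𝔖 k).loc (ΩblkOf 𝔠.lane.carrier.M₁ (rcolOf S 𝔠.lane.carrier) (nblkOf S 𝔠.lane.carrier k)) (rretOf S 𝔠.lane.carrier k) h,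
        ((jet26 ((𝔄.Λc k).Ψ Y) ((𝔖 k).Bcfg Y h U)).re - (𝔄.Λc k).far Y h U)
  /-- G3D-04 -/
  norm35 : Norm35StepAsCited (piecesAC 𝔠.lane X 𝔖 k) 𝔠.c35 𝔠.a35 𝔠.cv 𝔠.cJ35
  /-- G3D-05 -/
  logZT : LogZTExtensiveAsCited (piecesAC 𝔠.lane X 𝔖 k) 𝔠.cT 𝔠.aT 𝔠.cn 𝔠.cJT
  /-- R-ACT: the graph carrier's activities are the chart activities -/
  hact : ∀ h Y U, ((𝔖 k).Gt h).activities.act Y U = (𝔖 k).act h Y U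
  /-- G3D-02 -/
  hG : ∀ h, GraphRep23AsCited ((𝔖 k).Gt h) (fun U => ∑ n ∈ Finset.Icc 1 𝔠.nbar, (𝔖 k).cum h U n / (n.factorial : ℝ))
    (𝔄.C₂₃ k) (𝔄.c₂₃ k) (𝔄.M₂₃ k) (𝔄.δ₀ k)
  /-- [B1] (3.24) input (a), in the unit `(L^kg₀²)^{3+κ₀}|T₁^{(k)}|` -/
  h324a : ∀ h (U : GaugeField S.P (k + 1) G), |Real.log ((𝔖 k).μ.real ((𝔖 k).box h))| ≤
    𝔠.Ca * ((L : ℝ) ^ k * S.g0sq) ^ (3 + 𝔠.κ₀) * S.sites k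
  /-- [B1] (3.24) input (c) -/
  h324c : ∀ h U, ∀ t ∈ Set.Icc (0 : ℝ) 1, |iteratedDeriv (𝔠.nbar + 1) (ProbabilityTheory.cgf ((𝔖 k).𝒱 h U)
    (chiMeasure (𝔖 k).μ (((𝔖 k).box h).indicator fun _ => (1 : ℝ)))) t| ≤
      𝔠.Cc * ((𝔠.nbar + 1).factorial : ℝ) * ((L : ℝ) ^ k * S.g0sq) ^ (3 + 𝔠.κ₀) * S.sites k
  /-- (44) p. 267 on the previous-scale terms of the data (ONE row: consumers B15 and C10) -/
  h44 : ∀ (h : Hist S.P (k + 1)) (U : GaugeField S.P (k + 1) G), ∀ j ∈ Finset.Icc 1 k,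
    Bound44 (oldGeom S.P k j) (fun y n c => (𝔖 k).oldVal h U j y n c) 𝔠.κ₁ (𝔠.M₁ : ℝ) (ell S.P k j) (L : ℝ) 𝔠.B₃
      (S.gk k) (pFun 𝔠.b₀ 𝔠.p₀ (S.gk k)) 𝔠.C44
  /-- the degree floor «n ≥ 2» of (43) for the previous-scale terms -/
  hfloor : ∀ (h : Hist S.P (k + 1)) (U : GaugeField S.P (k + 1) G), ∀ j ∈ Finset.Icc 1 k,
    ∀ (y : Site S.P j) (n : ℕ) (c : Fin n → PBond S.P j), (𝔖 k).oldVal h U j y n c ≠ 0 → 2 ≤ n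
  /-- EXTERNAL-input property ([7] Thm 1): the composite minimizer map `U_k(·, h)` is measurable -/
  hU : ∀ h : Hist S.P k, Measurable (X.UkH k h)
  /-- data regularity: the interaction sum `Pint k h` of (43) (DEFINED from the activities) is measurable in `U` … -/
  hPm : ∀ h : Hist S.P k, Measurable ((inputOfAC 𝔠.lane X 𝔖).Pint k h)
  /-- … and bounded above -/
  hPb : ∀ (h : Hist S.P k) (U : GaugeField S.P k G), (inputOfAC 𝔠.lane X 𝔖).Pint k h U ≤ 𝔄.cP k
  /-- RESIDUAL R3D-01 (v3): (55) p.269 with (58) p.270 per new history, PINNED masses, print's `χ_{k+1}` window on the right (`PinnedStep.Fibre55WinAC`) -/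
  fibre55Win : ∀ h' : Hist S.P (k + 1), PinnedStep.Fibre55WinAC 𝔠.lane X 𝔖 win k h'

/-- **THE DATA CORE OF THE v3 INPUTS OF ONE LATTICE APPROXIMATION**: core step inputs for every `k < K`; (67) ∘ large field and (68) about the lifted composite minimizers
(`RunAlphaV3AC`'s text with `StepAlphaV3AC ↦ StepAlphaV3CoreAC`).  HYPOTHESES. [cite: Balaban1985UV3, (67)–(68) p.273 + pp.273–274] -/
structure RunAlphaV3CoreAC : Prop where
  /-- the step inputs -/
  steps : ∀ k, k + 1 ≤ S.K → StepAlphaV3CoreAC 𝔊 𝔠 X 𝔖 𝔄 win k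
  /-- (67) ∘ the large-field characteristic function of the history, on the averaged lifted minimizers -/
  hLF67 : ∀ k, k ≤ S.K → ∀ (h : Hist S.P k), Hist.Admissible 𝔠.lane.carrier.M₁ (rcolOf S 𝔠.lane.carrier) k h →
    ∀ (U : GaugeField S.P k G), ∀ e ∈ Hist.disc h, S.gk e.1 * pFun 𝔠.lane.carrier.b₀ 𝔠.lane.carrier.p₀ (S.gk e.1) ≤
      ‖((hol (avgIter L (liftCfg 𝔊 (X.UkH k h U)) e.1) (codeZ e) (plaqWord e.2.2.1 e.2.2.2) :
          (Matrix (Fin 𝔊.N) (Fin 𝔊.N) ℂ)ˣ) : Matrix (Fin 𝔊.N) (Fin 𝔊.N) ℂ) - 1‖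
  /-- (68) on the lifted minimizers -/
  h68 : ∀ k, k ≤ S.K → ∀ (h : Hist S.P k), Hist.Admissible 𝔠.lane.carrier.M₁ (rcolOf S 𝔠.lane.carrier) k h →
    ∀ (U : GaugeField S.P k G), ∀ e ∈ Hist.disc h,
      pdevOn (loK L e.1 (codeZ e)) (plaqHiK L e.1 (codeZ e) e.2.2.1 e.2.2.2) (liftCfg 𝔊 (X.UkH k h U)) <
        𝔠.C68 * (S.gk e.1 * pFun 𝔠.lane.carrier.b₀ 𝔠.lane.carrier.p₀ (S.gk e.1)) * (((L : ℝ) ^ e.1)⁻¹) ^ 2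


variable {𝔊 𝔠 X 𝔖 𝔄 win}

/-- The old record's step inputs project to the core (field by field; `fibre57Low` dropped). [folklore] -/
theorem StepAlphaV3AC.toCore {k : ℕ} (A : StepAlphaV3AC 𝔊 𝔠 X 𝔖 𝔄 win k) : StepAlphaV3CoreAC 𝔊 𝔠 X 𝔖 𝔄 win k where
  hμ := A.hμ
  hboxm := A.hboxm
  hbox := A.hbox
  hVm := A.hVm
  hVB := A.hVB
  chart := A.chart
  bound28 := A.bound28
  inv26 := A.inv26
  far_le := A.far_le
  hPY := A.hPY
  hPYZ := A.hPYZ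
  norm35 := A.norm35
  logZT := A.logZT
  hact := A.hact
  hG := A.hG
  h324a := A.h324a
  h324c := A.h324c
  h44 := A.h44
  hfloor := A.hfloor
  hU := A.hU
  hPm := A.hPm
  hPb := A.hPb
  fibre55Win := A.fibre55Win

/-- The old run record projects to the core. [folklore] -/
theorem RunAlphaV3AC.toCore (R : RunAlphaV3AC 𝔊 𝔠 X 𝔖 𝔄 win) : RunAlphaV3CoreAC 𝔊 𝔠 X 𝔖 𝔄 win :=
  ⟨fun k hk => (R.steps k hk).toCore, R.hLF67, R.h68⟩

end Alpha

/-! ## §2 The seven χ-free residual step leaves at the AC pieces and their derivation from the rows -/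

section Residuals

variable (𝔎 : LaneConsts L) {S : Scales L} {G : Type} [GaugeGroup G] [MeasurableSpace G] [HaarData G]
  {V : Type} [NormedAddCommGroup V] [NormedSpace ℂ V]
  (X : ExternalInputsAC S G) (𝔖 : ∀ k, StepSeries S G V (nblkOf S 𝔎.carrier k) k)

/-- **THE χ-FREE RESIDUAL STEP LEAVES of step `k → k+1` AT THE AC PIECES** — `AlphaV3AC.StepResidualsV3AC` WITHOUT C2 `Bound55Lower` (LQB's lower twin carries the tower's (4)-χ;
the χ-record's lower bound runs through `PinnedStep.ineq47On_ae` instead): C3–C8, C10 — all derivable from the CORE rows.  HYPOTHESES. [cite: Balaban1985UV3, (58)–(61) pp.270–271 + p.272] -/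
structure StepResidualsV3CoreAC (k : ℕ) : Prop where
  /-- C3: (24)/(58)–(59) -/
  cumulant58 : Cumulant58 (piecesAC 𝔎 X 𝔖 k) 𝔎.sc.Cz 𝔎.sc.C₁
  /-- C4: lower cumulant direction -/
  cumulantLower : CumulantLower (piecesAC 𝔎 X 𝔖 k) 𝔎.sc.C₁'
  /-- C5: (33)/(60) -/
  repr33_60 : Repr33_60 (piecesAC 𝔎 X 𝔖 k) 𝔎.sc.C₂
  /-- C6: whole-lattice vacuum sum -/
  vacuumWhole : VacuumWhole (piecesAC 𝔎 X 𝔖 k) 𝔎.sc.Cv 𝔎.sc.C₃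
  /-- C7: (35)/(61) -/
  decomp35_61 : Decomp35_61 (piecesAC 𝔎 X 𝔖 k) 𝔎.sc.C₄
  /-- C8: (35) normalisation -/
  norm35 : Norm35 (piecesAC 𝔎 X 𝔖 k) 𝔎.sc.C₅
  /-- C10: old terms outside Ω_{k+1}, p. 272 -/
  oldOutside : OldOutside (piecesAC 𝔎 X 𝔖 k) 𝔎.sc.C₆

end Residuals

section AlphaLeaves

variable {S : Scales L} {G : Type} [GaugeGroup G] [MeasurableSpace G] [HaarData G] {𝔊 : GroupModel G} {𝔠 : AlphaConsts L 𝔊.N}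
  {X : ExternalInputsAC S G} {𝔖 : ∀ k, StepSeries S G ↥(lieC 𝔊) (nblkOf S 𝔠.lane.carrier k) k} {𝔄 : AlphaDataAC 𝔊 𝔠 X 𝔖}
  {win : (k : ℕ) → Hist S.P (k + 1) → Set (GaugeField S.P (k + 1) G)}
  (hle : S.g ^ 2 * S.ε₀ ≤ (min 𝔠.gamma0 1) ^ 2)
include hle

/-- **(25) FOR THE ACTIVITIES from G3D-01 + (28)** at the AC pieces on the `≤`-family, from the core step rows (`AlphaV3AC.bound25_act_of_le`'s text).
[cite: Balaban1985UV3, (25) p.262 + (28)–(29) p.263] -/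
theorem bound25_act_of_le_core (k : ℕ) (hk : k + 1 ≤ S.K) (A : StepAlphaV3CoreAC 𝔊 𝔠 X 𝔖 𝔄 win k) (h : Hist S.P (k + 1)) :
    Bound25Printed ⟨(tsys 3 (nblkOf S 𝔠.lane.carrier k)).Dom, GaugeField S.P (k + 1) G, (tsys 3 (nblkOf S 𝔠.lane.carrier k)).dj,
      (𝔖 k).act h⟩ (S.gk k) 𝔠.κ 𝔠.C25 :=
  Summit.QuantumFields.Balaban3D.Proofs.ChartFromBound25.bound25_real_of_chart (T := towerOfAC 𝔠.lane X 𝔖) (k := k) (𝔖 k).Ψ A.chart (𝔖 k).Bcfg A.bound28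
    (thresholds_of_le hle k (by omega)).2.2.2.2 h

/-- **C10 AT THE AC PIECES FROM THE CORE STEP ROWS on the `≤`-family** (rows `h44`, `hfloor`; `Thm2AC.oldOutside_piecesAC`). [cite: Balaban1985UV3, p.272 L29–31 + (44) p.267] -/
theorem oldOutside_of_alphaV3Core_le (k : ℕ) (hk : k + 1 ≤ S.K) (A : StepAlphaV3CoreAC 𝔊 𝔠 X 𝔖 𝔄 win k) :
    OldOutside (piecesAC 𝔠.lane X 𝔖 k) 𝔠.lane.sc.C₆ :=
  oldOutside_piecesAC 𝔠.lane X 𝔖 k hk 𝔠.C44_nonneg 𝔠.B₃_pos.le 𝔠.κ₁_pos rfl A.h44 A.hfloor (thresholds_of_le hle k (by omega)).2.2.1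

/-- **THE SEVEN χ-FREE RESIDUAL STEP LEAVES AT THE AC PIECES FROM THE CORE STEP ROWS on the `≤`-family** — `AlphaV3AC.stepResidualsV3_of_alpha`'s wiring minus C2: C3–C8 by the
AC series leaves, C10 by `oldOutside_of_alphaV3Core_le`, thresholds from `g_k ≤ γ₀`. [cite: Balaban1985UV3, (58)–(61) pp.270–271 + p.272] -/
theorem stepResidualsV3Core_of_alpha (k : ℕ) (hk : k + 1 ≤ S.K) (A : StepAlphaV3CoreAC 𝔊 𝔠 X 𝔖 𝔄 win k) :
    StepResidualsV3CoreAC 𝔠.lane X 𝔖 k := by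
  haveI : RegularGaugeGroup G := groupModel_regularGaugeGroup 𝔊
  exact
  { cumulant58 := cumulant58_piecesAC 𝔠.lane X 𝔖 k hk A.hμ 𝔠.kappa_ge 𝔠.C25_nonneg 𝔠.one_le_r₀ 𝔠.R₁_ge
      𝔠.Cac_nonneg rfl rfl A.hact A.hboxm A.hbox A.hVm A.hVB A.h324a A.h324c A.hG (bound25_act_of_le_core hle k hk A)
    cumulantLower := cumulantLower_piecesAC 𝔠.lane X 𝔖 k hk A.hμ 𝔠.kappa_ge 𝔠.C25_nonneg 𝔠.one_le_r₀ 𝔠.R₁_ge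
      𝔠.Cac_nonneg rfl A.hact A.hboxm A.hbox A.hVm A.hVB A.h324a A.h324c A.hG (bound25_act_of_le_core hle k hk A)
    repr33_60 := repr33_60_piecesAC 𝔠.lane X 𝔖 k hk 𝔠.chart (by linarith [𝔠.kappa_ge]) 𝔠.C25_nonneg 𝔠.C25_le
      𝔠.κ₀_lt_half rfl A.chart A.bound28 (thresholds_of_le hle k (by omega)).2.2.2.2 (adjAct 𝔊 (P := S.P) k) A.inv26
      (hdet_adjAct 𝔊 k) A.far_le A.hPY
    vacuumWhole := vacuumWhole_piecesAC 𝔠.lane X 𝔖 k hk 𝔠.kappa_ge 𝔠.C25_nonneg 𝔠.one_le_r₀ 𝔠.R₁_ge rfl rfl A.chart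
    decomp35_61 := decomp35_61_piecesAC 𝔠.lane X 𝔖 k hk 𝔠.chart rfl 𝔠.kappa_ge 𝔠.C63_nonneg 𝔠.C63_le 𝔠.one_le_r₀
      𝔠.κ₀_lt_half 𝔠.R₁_ge rfl A.bound28 (thresholds_of_le hle k (by omega)).2.2.2.2 (adjAct 𝔊 (P := S.P) k) (hdet_adjAct 𝔊 k)
      (𝔄.Λc k) A.hPYZ
    norm35 := norm35_piecesAC 𝔠.lane X 𝔖 k 𝔠.c35_pos rfl A.norm35
    oldOutside := oldOutside_of_alphaV3Core_le hle k hk A }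

end AlphaLeaves

/-! ## §3 The exponent bookkeeping: (41)_{k+1} from the seven leaves, and the χ-free lower step (47)_{k+1} ≤ (37)/(57) -/

section Tower

variable (𝔎 : LaneConsts L) {S : Scales L} {G : Type} [GaugeGroup G] [MeasurableSpace G] [HaarData G]
  {V : Type} [NormedAddCommGroup V] [NormedSpace ℂ V]
  (X : ExternalInputsAC S G) (𝔖 : ∀ k, StepSeries S G V (nblkOf S 𝔎.carrier k) k)

/-- **THE (41)_{k+1} EXPONENT BOUND FOR THE AC TOWER FROM THE SEVEN χ-FREE LEAVES** (`AlphaV3AC.expo5558_le_expo41_succ_of_leaves` at `piecesAC`, with C9 `starCount_piecesAC`, C11/C12 by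
`rfl`, C13 `ztermSucc_piecesAC`, C14 `rmSucc_piecesAC`, and `0 < g_k ≤ 1`) — `expo5558_le_expo41_succ_AC`'s text over `StepResidualsV3CoreAC`.
[cite: Balaban1985UV3, (41) p.266 + (58)–(62) pp.270–271 + p.272] -/
theorem expo5558_le_expo41_succ_CoreAC (k : ℕ) (hk : k + 1 ≤ S.K) (R : StepResidualsV3CoreAC 𝔎 X 𝔖 k) (hh : Hist S.P (k + 1))
    (U : GaugeField S.P (k + 1) G) :
    -((towerOfAC 𝔎 X 𝔖).mainT (k + 1) hh U) - (towerOfAC 𝔎 X 𝔖).Ecst k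
        + ((piecesAC 𝔎 X 𝔖 k).logσ₀ + (piecesAC 𝔎 X 𝔖 k).dg * Real.log ((towerOfAC 𝔎 X 𝔖).g k)) * (piecesAC 𝔎 X 𝔖 k).starB hh
        + (piecesAC 𝔎 X 𝔖 k).logZU hh U + (piecesAC 𝔎 X 𝔖 k).Pold hh U
        + (towerOfAC 𝔎 X 𝔖).Zterm k ((piecesAC 𝔎 X 𝔖 k).proj hh) + (towerOfAC 𝔎 X 𝔖).Rm k + (piecesAC 𝔎 X 𝔖 k).logFl hh U ≤
      -((towerOfAC 𝔎 X 𝔖).mainT (k + 1) hh U) + (towerOfAC 𝔎 X 𝔖).Pint (k + 1) hh U - (towerOfAC 𝔎 X 𝔖).Ecst (k + 1)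
        + (towerOfAC 𝔎 X 𝔖).Zterm (k + 1) hh + (towerOfAC 𝔎 X 𝔖).Rm (k + 1) :=
  expo5558_le_expo41_succ_of_leaves (piecesAC 𝔎 X 𝔖 k) hk (gk_pos S k) (gk_le_one S S.gK_le_one k (by omega)) R.cumulant58 R.repr33_60
    R.vacuumWhole R.decomp35_61 R.norm35 (starCount_piecesAC 𝔎 X 𝔖 k hk) R.oldOutside ((X.toTowerBase 𝔎.carrier).pintSucc_seriesAC _ _ k)
    ((X.toTowerBase 𝔎.carrier).estep62_seriesAC _ _ k) (ztermSucc_piecesAC 𝔎 X 𝔖 k)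
    ((rmSucc_piecesAC 𝔎 X 𝔖 k).mono (by have := le_max_left 𝔎.sc.C₁ 𝔎.sc.C₁'; linarith)) hh U

/-- **THE χ-FREE LOWER EXPONENT STEP FOR THE AC TOWER FROM THE SEVEN LEAVES** (the lane's `RestrictedResiduals.expo47_succ_le_expo57` — the arithmetic of LQB's
`ineq47_succ_of_leaves` with the exponent as conclusion, no characteristic function — at `piecesAC`, with C9 `starCount_piecesAC`, C11/C12 by `rfl`, C14 `rmSucc_piecesAC`;
the `hexp` of `PinnedStep.ineq47On_ae`). [cite: Balaban1985UV3, (37) p.265 + p.272 L32–33] -/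
theorem expo47_succ_le_expo57_CoreAC (k : ℕ) (hk : k + 1 ≤ S.K) (R : StepResidualsV3CoreAC 𝔎 X 𝔖 k) (U : GaugeField S.P (k + 1) G) :
    -((towerOfAC 𝔎 X 𝔖).mainT (k + 1) (Hist.triv S.P (k + 1)) U) + (towerOfAC 𝔎 X 𝔖).Pint (k + 1) (Hist.triv S.P (k + 1)) U
        - (towerOfAC 𝔎 X 𝔖).Ecst (k + 1) - (towerOfAC 𝔎 X 𝔖).Rm (k + 1) ≤
      -((towerOfAC 𝔎 X 𝔖).mainT (k + 1) (Hist.triv S.P (k + 1)) U) - (towerOfAC 𝔎 X 𝔖).Ecst k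
        + ((piecesAC 𝔎 X 𝔖 k).logσ₀ + (piecesAC 𝔎 X 𝔖 k).dg * Real.log ((towerOfAC 𝔎 X 𝔖).g k)) *
            (piecesAC 𝔎 X 𝔖 k).starB (Hist.triv S.P (k + 1))
        + (piecesAC 𝔎 X 𝔖 k).logZU (Hist.triv S.P (k + 1)) U + (piecesAC 𝔎 X 𝔖 k).Pold (Hist.triv S.P (k + 1)) U
        - (towerOfAC 𝔎 X 𝔖).Rm k + (piecesAC 𝔎 X 𝔖 k).logFl (Hist.triv S.P (k + 1)) U :=
  Summit.QuantumFields.Balaban3D.Proofs.RestrictedResiduals.expo47_succ_le_expo57 (piecesAC 𝔎 X 𝔖 k) hk R.cumulantLower R.repr33_60 R.vacuumWhole R.decomp35_61 R.norm35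
    (starCount_piecesAC 𝔎 X 𝔖 k hk) R.oldOutside ((X.toTowerBase 𝔎.carrier).pintSucc_seriesAC _ _ k)
    ((X.toTowerBase 𝔎.carrier).estep62_seriesAC _ _ k)
    ((rmSucc_piecesAC 𝔎 X 𝔖 k).mono (by have := le_max_right 𝔎.sc.C₁ 𝔎.sc.C₁'; linarith)) U

end Tower

section AlphaTower

variable {S : Scales L} {G : Type} [GaugeGroup G] [MeasurableSpace G] [HaarData G] {𝔊 : GroupModel G} {𝔠 : AlphaConsts L 𝔊.N}
  {X : ExternalInputsAC S G} {𝔖 : ∀ k, StepSeries S G ↥(lieC 𝔊) (nblkOf S 𝔠.lane.carrier k) k} {𝔄 : AlphaDataAC 𝔊 𝔠 X 𝔖}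
  {win : (k : ℕ) → Hist S.P (k + 1) → Set (GaugeField S.P (k + 1) G)}
  (hle : S.g ^ 2 * S.ε₀ ≤ (min 𝔠.gamma0 1) ^ 2)
include hle

/-- **THE (41)_{k+1} EXPONENT BOUND, MODULO THE CORE ROWS** (hence for the old record and the χ-record alike), every `k < K`, every new history
(`AlphaV3AC.expo5558_le_expo41_succ_of_alphaV3`'s text). [cite: Balaban1985UV3, (41) p.266 + (58)–(62) pp.270–271] -/
theorem expo5558_le_expo41_succ_of_alphaV3Core (R : RunAlphaV3CoreAC 𝔊 𝔠 X 𝔖 𝔄 win) (k : ℕ) (hk : k + 1 ≤ S.K) (hh : Hist S.P (k + 1))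
    (U : GaugeField S.P (k + 1) G) :
    -((towerOfAC 𝔠.lane X 𝔖).mainT (k + 1) hh U) - (towerOfAC 𝔠.lane X 𝔖).Ecst k
        + ((piecesAC 𝔠.lane X 𝔖 k).logσ₀ + (piecesAC 𝔠.lane X 𝔖 k).dg * Real.log ((towerOfAC 𝔠.lane X 𝔖).g k)) * (piecesAC 𝔠.lane X 𝔖 k).starB hh
        + (piecesAC 𝔠.lane X 𝔖 k).logZU hh U + (piecesAC 𝔠.lane X 𝔖 k).Pold hh U
        + (towerOfAC 𝔠.lane X 𝔖).Zterm k ((piecesAC 𝔠.lane X 𝔖 k).proj hh) + (towerOfAC 𝔠.lane X 𝔖).Rm k + (piecesAC 𝔠.lane X 𝔖 k).logFl hh U ≤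
      -((towerOfAC 𝔠.lane X 𝔖).mainT (k + 1) hh U) + (towerOfAC 𝔠.lane X 𝔖).Pint (k + 1) hh U - (towerOfAC 𝔠.lane X 𝔖).Ecst (k + 1)
        + (towerOfAC 𝔠.lane X 𝔖).Zterm (k + 1) hh + (towerOfAC 𝔠.lane X 𝔖).Rm (k + 1) :=
  expo5558_le_expo41_succ_CoreAC 𝔠.lane X 𝔖 k hk (stepResidualsV3Core_of_alpha hle k hk (R.steps k hk)) hh U

end AlphaTower

end Summit.QuantumFields.YangMills.Theorems.AlphaV3AC

end
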